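import Summits.CriticalPhenomena.PercolationContinuityZ3.Theorems.PercNearOneGluingNoHeavyLowerTailSahiLatinZeros

/-!
# `NoHeavyLowerTail` (crux stmt-CriticalPhenomena-4575), Sahi programme (prim-master-conj gen 43): ZEROS of the Latin kernel `κ_d`, II —
# essential axes, INDEPENDENT pairs, "pairwise independent ⟹ terminal", and "`κ(Ω,b,c) = 0 ⟹ b ⊥ c`" (every dimension)

Support file (`--supports stmt-CriticalPhenomena-4575`; sequel of `…SahiLatinZeros`, prequel of `…SahiLatinZeroDescent`; memo
`run/shared/lean/prim/prim-l12/FROM-prim-master-conj-g43-ZERO-LOCUS.md`).  Vocabulary of `…SahiLatinKernel/Moves/Descent/Harris/Zeros`.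

THE MATHEMATICS (all `d`; everything PROVED, axioms standard).
1. `AxisInessential s i` (changing coordinate `i` never changes membership in `s ⊆ [3]^ι`), `Indep s t` (every axis is inessential for `s` or for
   `t` — the two sets have disjoint essential supports); `mem_iff_mem_of_agree` (points agreeing off inessential axes have the same membership).
2. **`terminal_of_indep`**: three pairwise independent up-sets, each nonempty and `≠ ⊤`, form a TERMINAL triple of `…SahiLatinDescent` (a maximal
   non-element of `a` equals `2` on every `a`-inessential axis, hence lies in `b` and in `c`; a minimal element equals `0` there, hence lies outside
   `b` and `c`).  (Such triples have `κ = 0`: the Sahi cell's `SahiGridPattern.sStarD_eq_zero_of_threeIndep`, prim-sahi-p1 gen 14, via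
   `SahiLatin.kappa_eq_sStarD`.)
3. FROM LINKS TO AXES: **`indep_of_forall_inessential_or`** — if on EVERY link `link(u)` every axis is inessential for the trace of `b` or for the
   trace of `c`, then `b ⊥ c` globally (an axis essential for both up-sets is seen on the link of a point with middle level on that axis and
   levels avoiding two witnesses elsewhere); hence **`indep_of_kappa_univ_eq_zero`**: for up-sets, `κ(Ω,b,c) = 0 ⟹ b ⊥ c` — the equality case of
   coefficientwise Harris (`…SahiLatinHarris.kappa_univ_nonneg`) in the `SahiLatin` vocabulary and every index type (for `ι = Fin d` this is the
   `⟹` half of the Sahi cell's `SahiGridPattern.sStarD_univ_eq_zero_iff`, prim-sahi-p1 gen 14).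
4. Degenerate slots: `∅` and `⊤` are independent of everything; a slot can be `∅` in a terminal triple only if the other two are `⊤`
   (`eq_univ_of_C2_empty`).
[this work]
-/

namespace Summit.CriticalPhenomena.PercolationContinuityZ3.Theorems.SahiLatin

open Finset

variable {ι : Type*} [Fintype ι] [DecidableEq ι]

/-! ## §1  Essential axes and independent pairs; pairwise independent triples are terminal -/

/-- Axis `i` is INESSENTIAL for `s ⊆ [3]^ι`: changing the `i`-th coordinate never changes membership in `s`. [this work] -/
def AxisInessential (s : Finset (Pt ι)) (i : ι) : Prop := ∀ (x : Pt ι) (v : Fin 3), Function.update x i v ∈ s ↔ x ∈ s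

/-- Two subsets of `[3]^ι` are INDEPENDENT: every axis is inessential for one of them (their essential supports are disjoint). [this work] -/
def Indep (s t : Finset (Pt ι)) : Prop := ∀ i, AxisInessential s i ∨ AxisInessential t i

omit [Fintype ι] in
/-- Independence is symmetric. [this work] -/
theorem Indep.symm {s t : Finset (Pt ι)} (h : Indep s t) : Indep t s := fun i => (h i).symm

/-- Points that agree on all axes except `s`-inessential ones have the same membership in `s`. [this work] -/
theorem mem_iff_mem_of_agree {s : Finset (Pt ι)} {x y : Pt ι} (h : ∀ i, x i = y i ∨ AxisInessential s i) : x ∈ s ↔ y ∈ s := by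
  suffices H : ∀ (D : Finset ι) (x y : Pt ι), (∀ i, i ∉ D → x i = y i) → (∀ i ∈ D, AxisInessential s i) → (x ∈ s ↔ y ∈ s) by
    refine H (univ.filter fun i => x i ≠ y i) x y (fun i hi => ?_) (fun i hi => ?_)
    · by_contra hne
      exact hi (mem_filter.2 ⟨mem_univ _, hne⟩)
    · rcases h i with h' | h'
      · exact absurd h' (mem_filter.1 hi).2
      · exact h'
  intro D
  refine Finset.induction_on D ?_ ?_
  · intro x y hxy _
    have : x = y := funext fun i => hxy i (by simp)
    rw [this]
  · intro i D hiD ih x y hxy hD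
    have hz : x ∈ s ↔ Function.update y i (x i) ∈ s := by
      refine ih x (Function.update y i (x i)) (fun j hj => ?_) (fun j hj => hD j (mem_insert_of_mem hj))
      by_cases hji : j = i
      · subst hji; simp
      · rw [Function.update_of_ne hji]
        exact hxy j (by simp [hji, hj])
    rw [hz]
    exact hD i (mem_insert_self _ _) y (x i)

omit [Fintype ι] [DecidableEq ι] in
/-- A nonempty up-set contains the top point `(2,…,2)`. [this work] -/
theorem top_mem_of_nonempty {s : Finset (Pt ι)} (hs : IsUpperSet (s : Set (Pt ι))) (hne : s.Nonempty) :
    (fun _ => (2 : Fin 3)) ∈ s := by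
  obtain ⟨x, hx⟩ := hne
  exact hs (show x ≤ fun _ => (2 : Fin 3) from fun i => Fin.le_iff_val_le_val.2 (by
    have := (x i).isLt; simp only [Fin.val_two]; omega)) hx

/-- An up-set containing the bottom point `(0,…,0)` is everything. [this work] -/
theorem eq_univ_of_bot_mem {s : Finset (Pt ι)} (hs : IsUpperSet (s : Set (Pt ι))) (h : (fun _ => (0 : Fin 3)) ∈ s) :
    s = univ :=
  eq_univ_of_forall fun x => hs (show (fun _ => (0 : Fin 3)) ≤ x from fun _ => Fin.zero_le _) h

omit [Fintype ι] in
/-- A maximal non-element of `a` takes the top level on every `a`-inessential axis. [this work] -/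
theorem IsMaxOut.apply_eq_two {a : Finset (Pt ι)} {m : Pt ι} (hm : IsMaxOut a m) {i : ι} (hi : AxisInessential a i) :
    m i = 2 := by
  by_contra hne
  have hle : m ≤ Function.update m i 2 := fun j => by
    by_cases hji : j = i
    · subst hji
      rw [Function.update_self]
      exact Fin.le_iff_val_le_val.2 (by have := (m j).isLt; simp only [Fin.val_two]; omega)
    · rw [Function.update_of_ne hji]
  have hneq : Function.update m i 2 ≠ m := fun h => hne (by rw [← h, Function.update_self])
  exact hm.1 ((hi m 2).1 (hm.2 _ hle hneq))

omit [Fintype ι] in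
/-- A minimal element of `a` takes the bottom level on every `a`-inessential axis. [this work] -/
theorem IsMinOf.apply_eq_zero {a : Finset (Pt ι)} {m : Pt ι} (hm : IsMinOf a m) {i : ι} (hi : AxisInessential a i) :
    m i = 0 := by
  by_contra hne
  have hle : Function.update m i 0 ≤ m := fun j => by
    by_cases hji : j = i
    · subst hji
      rw [Function.update_self]
      exact Fin.zero_le _
    · rw [Function.update_of_ne hji]
  have hmem : Function.update m i 0 ∈ a := (hi m 0).2 hm.1
  have h := hm.2 _ hmem hle
  exact hne (by rw [← h, Function.update_self])

/-- A maximal non-element of `a` lies in every nonempty up-set independent of `a`. [this work] -/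
theorem IsMaxOut.mem_of_indep {a b : Finset (Pt ι)} {m : Pt ι} (hm : IsMaxOut a m) (hab : Indep a b)
    (hb : IsUpperSet (b : Set (Pt ι))) (hbne : b.Nonempty) : m ∈ b := by
  refine (mem_iff_mem_of_agree (s := b) (x := m) (y := fun _ => (2 : Fin 3)) fun i => ?_).2 (top_mem_of_nonempty hb hbne)
  rcases hab i with h | h
  · exact Or.inl (hm.apply_eq_two h)
  · exact Or.inr h

/-- A minimal element of `a` lies outside every proper up-set independent of `a`. [this work] -/
theorem IsMinOf.not_mem_of_indep {a b : Finset (Pt ι)} {m : Pt ι} (hm : IsMinOf a m) (hab : Indep a b)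
    (hb : IsUpperSet (b : Set (Pt ι))) (hbU : b ≠ univ) : m ∉ b := by
  intro hmb
  refine hbU (eq_univ_of_bot_mem hb ((mem_iff_mem_of_agree (s := b) (x := m) (y := fun _ => (0 : Fin 3)) fun i => ?_).1 hmb))
  rcases hab i with h | h
  · exact Or.inl (hm.apply_eq_zero h)
  · exact Or.inr h

/-- **PAIRWISE INDEPENDENT PROPER UP-SETS FORM A TERMINAL TRIPLE** (all `d`).  (They also have `κ = 0`: the Sahi cell's
`SahiGridPattern.sStarD_eq_zero_of_threeIndep` through `kappa_eq_sStarD`.) [this work] -/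
theorem terminal_of_indep {a b c : Finset (Pt ι)} (hup : UpTriple a b c)
    (ha : a.Nonempty) (ha' : a ≠ univ) (hb : b.Nonempty) (hb' : b ≠ univ) (hc : c.Nonempty) (hc' : c ≠ univ)
    (hab : Indep a b) (hac : Indep a c) (hbc : Indep b c) : Terminal a b c where
  c1a := fun _ hm h => (hm.not_mem_of_indep hab hup.2.1 hb') h.1
  c1b := fun _ hm h => (hm.not_mem_of_indep hbc hup.2.2 hc') h.2
  c1c := fun _ hm h => (hm.not_mem_of_indep hac.symm hup.1 ha') h.1
  c2a := fun _ hm => ⟨hm.mem_of_indep hab hup.2.1 hb, hm.mem_of_indep hac hup.2.2 hc⟩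
  c2b := fun _ hm => ⟨hm.mem_of_indep hab.symm hup.1 ha, hm.mem_of_indep hbc hup.2.2 hc⟩
  c2c := fun _ hm => ⟨hm.mem_of_indep hac.symm hup.1 ha, hm.mem_of_indep hbc.symm hup.2.1 hb⟩


/-! ## §2  From links to axes: `κ(Ω,b,c) = 0 ⟹ b ⊥ c` -/

omit [Fintype ι] in
/-- An up-set with an essential axis `i` JUMPS along `i` somewhere: some point is outside with `i`-th coordinate `0` and inside with `2`.
[this work] -/
theorem exists_jump_of_not_axisInessential {b : Finset (Pt ι)} (hb : IsUpperSet (b : Set (Pt ι))) {i : ι}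
    (h : ¬ AxisInessential b i) : ∃ p : Pt ι, Function.update p i 0 ∉ b ∧ Function.update p i 2 ∈ b := by
  simp only [AxisInessential, not_forall] at h
  obtain ⟨x, v, hxv⟩ := h
  have h02 : ∀ w : Fin 3, (0 : Fin 3) ≤ w ∧ w ≤ 2 := by decide
  have hle0 : ∀ w : Fin 3, Function.update x i 0 ≤ Function.update x i w := fun w j => by
    by_cases hji : j = i
    · subst hji; rw [Function.update_self, Function.update_self]; exact (h02 w).1
    · rw [Function.update_of_ne hji, Function.update_of_ne hji]
  have hle2 : ∀ w : Fin 3, Function.update x i w ≤ Function.update x i 2 := fun w j => by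
    by_cases hji : j = i
    · subst hji; rw [Function.update_self, Function.update_self]; exact (h02 w).2
    · rw [Function.update_of_ne hji, Function.update_of_ne hji]
  have hxx : Function.update x i (x i) = x := Function.update_eq_self i x
  by_cases hx : x ∈ b
  · have hq : Function.update x i v ∉ b := fun h' => hxv ⟨fun _ => hx, fun _ => h'⟩
    refine ⟨x, fun h0 => hq (hb (hle0 v) h0), hb ?_ hx⟩
    calc x = Function.update x i (x i) := hxx.symm
      _ ≤ Function.update x i 2 := hle2 (x i)
  · have hq : Function.update x i v ∈ b := by
      by_contra h'
      exact hxv ⟨fun h => absurd h h', fun h => absurd h hx⟩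
    refine ⟨x, fun h0 => hx (hb ?_ h0), hb (hle2 v) hq⟩
    calc Function.update x i 0 ≤ Function.update x i (x i) := hle0 (x i)
      _ = x := hxx

/-- Any two levels of `Fin 3` are avoided by a third (finite check). [this work] -/
theorem exists_ne_ne : ∀ a b : Fin 3, ∃ w : Fin 3, w ≠ a ∧ w ≠ b := by decide

/-- `hi 1 = 2` (finite check). [this work] -/
theorem hi_one : hi (1 : Fin 3) = 2 := by decide

/-- **FROM LINKS TO AXES** (all `d`).  If for every point `u` every axis is inessential for the trace of `b` or for the trace of `c` on
`link(u)`, then the up-sets `b, c` are independent.  (If axis `i` were essential for both, take jump witnesses `p⁰ ∉ b ∋ p²`, `r⁰ ∉ c ∋ r²`;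
the point `u` with `u_i = 1` and `u_j ∉ {p_j, r_j}` elsewhere has all four in its link, as the pairs `S, S ∪ {i}` of the cube.) [this work] -/
theorem indep_of_forall_inessential_or {b c : Finset (Pt ι)} (hb : IsUpperSet (b : Set (Pt ι))) (hc : IsUpperSet (c : Set (Pt ι)))
    (h : ∀ (u : Pt ι) (i : ι), FiveUpSet.Inessential i (fam u b) ∨ FiveUpSet.Inessential i (fam u c)) : Indep b c := by
  intro i
  by_contra hnot
  rw [not_or] at hnot
  obtain ⟨p, hp0, hp2⟩ := exists_jump_of_not_axisInessential hb hnot.1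
  obtain ⟨r, hr0, hr2⟩ := exists_jump_of_not_axisInessential hc hnot.2
  choose w hw using fun j => exists_ne_ne (p j) (r j)
  set u : Pt ι := Function.update w i 1 with hu
  have hui : u i = 1 := by rw [hu, Function.update_self]
  have huj : ∀ j, j ≠ i → u j = w j := fun j hj => by rw [hu, Function.update_of_ne hj]
  -- the four witnesses lie in the link of `u`
  have hlink : ∀ (q : Pt ι), (∀ j, w j ≠ q j) → ∀ v : Fin 3, v ≠ 1 → Function.update q i v ∈ link u := by
    intro q hq v hv
    rw [mem_link]
    intro j
    by_cases hji : j = i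
    · subst hji; rw [Function.update_self, hui]; exact hv
    · rw [Function.update_of_ne hji, huj j hji]; exact (hq j).symm
  have hp : ∀ j, w j ≠ p j := fun j => (hw j).1
  have hr : ∀ j, w j ≠ r j := fun j => (hw j).2
  have h01 : (0 : Fin 3) ≠ 1 := by decide
  have h21 : (2 : Fin 3) ≠ 1 := by decide
  -- encoding: `toSet u (q with i ↦ 2) = insert i (toSet u (q with i ↦ 0))`, and `i ∉ toSet u (q with i ↦ 0)`
  have henc : ∀ q : Pt ι, toSet u (Function.update q i 2) = insert i (toSet u (Function.update q i 0)) := by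
    intro q
    ext j
    rw [mem_insert, mem_toSet, mem_toSet]
    by_cases hji : j = i
    · subst hji
      rw [Function.update_self, Function.update_self, hui, hi_one]
      simp
    · rw [Function.update_of_ne hji, Function.update_of_ne hji]
      simp [hji]
  have hnot0 : ∀ q : Pt ι, i ∉ toSet u (Function.update q i 0) := by
    intro q
    rw [mem_toSet, Function.update_self, hui, hi_one]
    decide
  -- use the hypothesis at `u`
  have key : ∀ {s : Finset (Pt ι)} {q : Pt ι}, (∀ j, w j ≠ q j) → FiveUpSet.Inessential i (fam u s) →
      (Function.update q i 2 ∈ s ↔ Function.update q i 0 ∈ s) := by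
    intro s q hq hI
    have h2 := (inessential_fam_iff u s i).1 hI (toSet u (Function.update q i 0)) (hnot0 q)
    rw [← henc q, ofSet_toSet (hlink q hq 2 h21), ofSet_toSet (hlink q hq 0 h01)] at h2
    exact h2
  rcases h u i with hI | hI
  · exact hp0 ((key hp hI).1 hp2)
  · exact hr0 ((key hr hI).1 hr2)

/-- **`κ(Ω,b,c) = 0 ⟹ b ⊥ c`** for up-sets (all `d`): the equality case of coefficientwise Harris.  (`κ(Ω,b,c) = Σ_u (N_{b∩c}(u) − Λ_{bc}(u))`
is a sum of nonnegative Kleitman gaps; all vanish; links to axes.) [this work] -/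
theorem indep_of_kappa_univ_eq_zero {b c : Finset (Pt ι)} (hb : IsUpperSet (b : Set (Pt ι))) (hc : IsUpperSet (c : Set (Pt ι)))
    (h0 : kappa univ b c = 0) : Indep b c := by
  refine indep_of_forall_inessential_or hb hc fun u i => ?_
  have hsum : ∑ u : Pt ι, ((N (b ∩ c) u : ℤ) - Lam b c u) = 0 := by rw [← kappa_univ]; exact h0
  have hnn : ∀ u ∈ (univ : Finset (Pt ι)), (0 : ℤ) ≤ (N (b ∩ c) u : ℤ) - Lam b c u := fun u _ => by
    have h1 : (Lam b c u : ℤ) ≤ N (b ∩ c) u := by exact_mod_cast Lam_le_N hb hc u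
    linarith
  have hz := (Finset.sum_eq_zero_iff_of_nonneg hnn).1 hsum u (mem_univ u)
  have hLN : Lam b c u = N (b ∩ c) u := by
    have : (Lam b c u : ℤ) = N (b ∩ c) u := by linarith
    exact_mod_cast this
  refine FiveUpSet.inessential_or_of_kleitman_eq (isUpperSet_fam u hb) (isUpperSet_fam u hc) ?_ i
  rw [← antipode_eq_refl, card_fam_inter_antipode, fam_inter, card_fam, hLN]

/-! ## §3  Degenerate slots -/

omit [Fintype ι] in
/-- Every axis is inessential for `∅`. [this work] -/
theorem axisInessential_empty (i : ι) : AxisInessential (∅ : Finset (Pt ι)) i := fun x v => by simp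

/-- Every axis is inessential for `⊤`. [this work] -/
theorem axisInessential_univ (i : ι) : AxisInessential (univ : Finset (Pt ι)) i := fun x v => by simp

omit [Fintype ι] in
/-- `∅` is independent of everything. [this work] -/
theorem indep_empty_left (t : Finset (Pt ι)) : Indep ∅ t := fun i => Or.inl (axisInessential_empty i)

/-- `⊤` is independent of everything. [this work] -/
theorem indep_univ_left (t : Finset (Pt ι)) : Indep univ t := fun i => Or.inl (axisInessential_univ i)

/-- In a terminal triple a slot can be EMPTY only if the other slots are `⊤`: (C2) for `b` against `∅, c` forces `b = ⊤` (a maximal element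
of `bᶜ` would have to lie in `∅`). [this work] -/
theorem eq_univ_of_C2_empty {b c : Finset (Pt ι)} (h : C2 b ∅ c) : b = univ := by
  by_contra hne
  have hcomp : (bᶜ : Finset (Pt ι)).Nonempty := by
    rw [nonempty_iff_ne_empty, Ne, compl_eq_empty_iff]; exact hne
  obtain ⟨m, hm⟩ := Finset.exists_maximal hcomp
  have hmax : IsMaxOut b m := by
    refine ⟨mem_compl.1 hm.1, fun y hmy hym => ?_⟩
    by_contra hy
    exact hym (le_antisymm (hm.2 (mem_compl.2 hy) hmy) hmy)
  exact notMem_empty m (h m hmax).1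

/-- Symmetric form: (C2) for `b` against `c, ∅` forces `b = ⊤`. [this work] -/
theorem eq_univ_of_C2_empty_right {b c : Finset (Pt ι)} (h : C2 b c ∅) : b = univ :=
  eq_univ_of_C2_empty fun m hm => ⟨(h m hm).2, (h m hm).1⟩

end Summit.CriticalPhenomena.PercolationContinuityZ3.Theorems.SahiLatin
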